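import Mathlib
import HarnessLib
import Summits.Ventures.LatticeQCDFlow.Exactness.OpenBoundaryWilsonAction
import Summits.Ventures.LatticeQCDFlow.Exactness.CabibboMarinariLatticeErgodic

/-!
# Open temporal boundary: the `SU(N)` Cabibbo–Marinari heat-bath sweep on the open-boundary action converges from every start

HONEST FRAMING: exact (Metropolis-corrected) sampling algorithms for lattice gauge theory;
figures of merit are autocorrelation/cost numbers at stated couplings and volumes; no
continuum-physics claim.

Venture `LatticeQCDFlow` (cell pub-lqcd), topic `Exactness`, FANOUT row 21 (`su3-base`: open boundary conditions in
time as the engine runs them — plaquette weights on the periodic lattice, every update honouring the weights; the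
row's baselines pair the local `1HB + 4OR` update with HMC).  NEW WORK of the cell: the one-line instance of row 9's
`CabibboMarinariLatticeErgodic.latSweep_uniformlyErgodic_of_continuous` (the lattice sweep of Cabibbo–Marinari
`SU(2)`-subgroup heat-bath hits for ANY continuous action) at row 21's open-boundary action `β · obcAction ρ τ`
(`OpenBoundaryWilsonAction.lean`: continuous, blind to the wrap links).  Nothing is cited as a fact; no number; no
definition is introduced.

* **`obc_cmSweep_uniformlyErgodic`** — `G = SU(N)` (`N ≥ 1`, colour index type `n` linearly ordered), continuous
  representation `ρ`, any real `β`, any time direction `τ`, torus `(ℤ/L)^d`: the sweep of Cabibbo–Marinari heat-bath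
  link updates for the joint density `e^{−β S_OBC}` (frames through all coordinate pairs lexicographically or reversed,
  every link visited) satisfies `|μ₀Kᵗ(A) − π_OBC(A)| ≤ (1 − ε)ᵗ` for some `ε > 0`, EVERY initial law, every `t`, every
  set, with `π_OBC = piGibbsLaw Haar^{⊗} (gibbsDensity (β S_OBC))` the open-boundary Gibbs law.

NOT CLAIMED: any rate; the over-relaxation interleaving (exact, composes as in `CabibboMarinariORSweep`; not
restated); that the engine's weighted-staple heat bath IS this kernel (it is the same one-link law with the weighted
staple sum — row 9's note in `PTBCWilsonDefect`); floating point.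
-/

noncomputable section

namespace Summit.Ventures.LatticeQCDFlow.Exactness

open MeasureTheory
open Literature.MathematicalPhysics.QuantumFieldTheory

variable {n : Type*} [Fintype n] [DecidableEq n] [Nonempty n] [LinearOrder n] {m : Type*} [Fintype m] [DecidableEq m]
  {d L M : ℕ} [NeZero L] (ρ : Matrix.specialUnitaryGroup n ℂ →* Matrix (Fin M) (Fin M) ℂ)

/-- **THE CABIBBO–MARINARI HEAT-BATH SWEEP ON THE OPEN-BOUNDARY ACTION CONVERGES FROM EVERY START.** -/
theorem obc_cmSweep_uniformlyErgodic (hρ : Continuous ρ) (τ : Fin d) (β : ℝ) (frames : List (n ≃ Fin 2 ⊕ m))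
    (hlex : frames.map pairOf = lexPairs (Finset.univ.sort (· ≤ ·) : List n) ∨
      frames.map pairOf = (lexPairs (Finset.univ.sort (· ≤ ·) : List n)).reverse)
    {links : List (Edge d L)} (hl : ∀ e, e ∈ links) :
    ∃ ε : ℝ, 0 < ε ∧ ∀ (μ₀ : Measure (GaugeConfig d L (Matrix.specialUnitaryGroup n ℂ))) [IsProbabilityMeasure μ₀]
      (t : ℕ) (A : Set (GaugeConfig d L (Matrix.specialUnitaryGroup n ℂ))),
      |((fun ν : Measure (GaugeConfig d L (Matrix.specialUnitaryGroup n ℂ)) =>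
          ν.bind (latSweep (gibbsDensity fun U => β * obcAction ρ τ U) frames links))^[t] μ₀).real A
        - (piGibbsLaw (linkHaar (Edge d L) n) (gibbsDensity fun U => β * obcAction ρ τ U)).real A| ≤ (1 - ε) ^ t :=
  latSweep_uniformlyErgodic_of_continuous (continuous_const.mul (continuous_obcAction ρ hρ τ)) frames hlex hl

end Summit.Ventures.LatticeQCDFlow.Exactness
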